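import Summits.HodgeConjecture.HodgeConjecture.Theorems.H413E2SWBorelBoundFrame
import Literature.NumberTheory.Weil1964.AdelicMetaplecticImplementerModulusBound
import Literature.NumberTheory.Automorphic.UnitaryGroupOfFormAdelicTopology
import HarnessLib

/-!
# Crux H413, E-2 child line `F0_E2SiegelWeilWeilRange`, row SW2c-BOUND: (**)′ IN THE δ♮-FRAME WITH (IMPL)+(DOM-C) READ FROM A
# HOMOMORPHIC LIFT — `exists_borelBound_frame` with `hIMPL` discharged from a continuous splitting `s : U_D → Mp` over `j`

HC_CM is proved only modulo the printed citations until rung 0 closes; nothing in this file is about HC.  Cell `hodgecm-mathlib`,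
floor 0, programme P4, engine E-2, item stmt-HodgeConjecture-24833 (`--supports`); seat F0P4-p07 (g3); sheet `F0/P4/SW2c-BOUND-ASSEMBLY.v1`
(8e2768b2) §B (IMPL)/(DOM-C), A6 (generic half) of its landing order.

THE STEP ([Weil1965] n° 47 Lemme 20 and n° 50, proof of Thm. 4, the compact factor `k` of `b = γ⁻¹ b′ k`): ★ A4
`E2SWBorelBoundFrame.exists_borelBound_frame` asks, for every compact `C ⊆ U_D = U(T_W ⊕ −T_W)(𝔸_F)`, for implementers `q_k ∈ Mp` over
`j k`, with moduli `L(q_k) ≥ c₁ > 0` and ONE Schwartz–Bruhat function dominating all `ω(q_k)Φ` (its hypothesis `hIMPL`).  When the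
`W`-side hom `jS` LIFTS to a coefficient-continuous homomorphism `s : U_D → Mp` (a compatible splitting of the metaplectic extension over
the member `U_D` of the doubled pair — [GelbartRogawski1991] §3.2, [Li1992] p. 181 — conjugated into the frame of record by
`ũ = u₀ · doublingDeltaLift`), the implementers are `q_k := ũ · s(k) · ũ⁻¹`: they lie over `j k = conj(π ũ)(spReindex (jS k))` (`hproj`, read
through the pair embedding exactly as `hjS`); their moduli are bounded below on compacta because `L` is conjugation-invariant and continuous
along `s` (★ `adelicMpCont.exists_pos_le_l2Scaling_conj_comp_of_isCompact`, [Weil1964] Chap. I n° 13, Steinhaus–Weil); and the domination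
is the hypothesis `hdom` over compact subsets of `U_D` (the theta-majorant letter (DOM-C), ★ `Weil1964.AdelicCompactFamilyDominatedConj` at
the CM datum).  `U_D` is closed in `GL₂(𝔸_E)` (★ `UnitaryGroup.isClosed_adelic`), so a compact `C ⊆ GL₂(𝔸_E)` is compact read in `U_D`.

THE THEOREM `exists_borelBound_frame_of_hom`: ★ `exists_borelBound_frame` with `hIMPL` replaced by `(s, hs, hproj, hdom)`; the remaining
hypotheses are (INV) `hINV` and the (Î)/(E_X) structure letters, unchanged.

References: A. Weil, *Sur la formule de Siegel dans la théorie des groupes classiques*, Acta Math. 113 (1965), n° 47 Lemme 20, n° 50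
[Weil1965]; A. Weil, *Sur certains groupes d'opérateurs unitaires*, Acta Math. 111 (1964), Chap. I n° 13 p. 160 [Weil1964];
S. Gelbart, J. Rogawski, *L-functions and Fourier–Jacobi coefficients for the unitary group U(3)*, Invent. Math. 105 (1991), §3.2
[GelbartRogawski1991]; J.-S. Li, J. reine angew. Math. 428 (1992), p. 181 [Li1992].
-/

set_option autoImplicit false

noncomputable section

set_option linter.dupNamespace false

namespace Summit.HodgeConjecture.HodgeConjecture.Cruxes.H413.E2SWBorelBoundFrameHom

open scoped NNReal ENNReal Matrix
open _root_.MeasureTheory NumberField IsDedekindDomain Matrix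
open Literature.RepresentationTheory.HeisenbergGroup
open Literature.NumberTheory.Weil1964 Literature.NumberTheory.Weil1965 Literature.NumberTheory.Automorphic
open Literature.NumberTheory.Automorphic.DoubledUnitary.RankOneReduction
open Literature.NumberTheory.Automorphic.UnitaryGroup
open Literature.NumberTheory.GelbartRogawski1991 Literature.NumberTheory.GelbartRogawski1991.UnitaryDualPair

variable (F E : Type) [Field F] [NumberField F] [Field E] [NumberField E] [Algebra F E] [Algebra.IsQuadraticExtension F E]
  (c : E ≃ₐ[F] E) {δ : E} (hcδ : c δ = -δ) (hδ : δ ≠ 0) {d : F} (hd : δ * δ = algebraMap F E d)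
  (N : ℕ) {n : ℕ} (e : Fin N × Fin 1 ≃ Fin n)
  {TV : Matrix (Fin N) (Fin N) F} (TW : Matrix (Fin 1) (Fin 1) F) (hV : TV.IsSymm)
  (hW2 : (Matrix.reindex finSumFinEquiv finSumFinEquiv (Matrix.fromBlocks TW 0 0 (-TW))).IsSymm)
  (hVd : IsUnit TV.det) (hWd : IsUnit TW.det)

/-- `(conj(p) ∘ g ∘ f)(u) = p · g(f u) · p⁻¹` (definitional; isolated so that the hom of record `j` is never unfolded in a large context).
[folklore] -/
theorem conj_comp_comp_apply {G H K : Type*} [Group G] [Group H] [Group K] (p : G) (g : K →* G) (f : H →* K) (u : H) :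
    ((MulAut.conj p).toMonoidHom.comp (g.comp f)) u = p * g (f u) * p⁻¹ := rfl

/-- `π(u₀ · δ̃ · x · (u₀ · δ̃)⁻¹) = π u₀ · π δ̃ · spReindex g · (π u₀ · π δ̃)⁻¹` when `π x = spReindex g` (`δ̃ = doublingDeltaLift`): the
implementer `ũ · s(k) · ũ⁻¹` lies over the hom of record `j k`. [folklore] -/
theorem proj_conj_frame_eq (T : Matrix (Fin n) (Fin n) (AdeleRing (𝓞 F) F)) (hT : IsUnit T.det)
    (u₀ x : adelicMpCont F (Fin (n + n)) (doubledGramFin F T))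
    (g : symplecticGroup (polar (Matrix.toLinearMap₂' (AdeleRing (𝓞 F) F) (Matrix.fromBlocks T 0 0 (-T)))))
    (hx : adelicMpCont.proj F (Fin (n + n)) (doubledGramFin F T) x =
      spReindex (finSumFinEquiv : Fin n ⊕ Fin n ≃ Fin (n + n)) (Matrix.fromBlocks T 0 0 (-T)) g) :
    adelicMpCont.proj F (Fin (n + n)) (doubledGramFin F T)
        (u₀ * doublingDeltaLift F T hT * x * (u₀ * doublingDeltaLift F T hT)⁻¹) =
      adelicMpCont.proj F (Fin (n + n)) (doubledGramFin F T) u₀ * adelicMpCont.proj F (Fin (n + n)) (doubledGramFin F T) (doublingDeltaLift F T hT) *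
        spReindex (finSumFinEquiv : Fin n ⊕ Fin n ≃ Fin (n + n)) (Matrix.fromBlocks T 0 0 (-T)) g *
        (adelicMpCont.proj F (Fin (n + n)) (doubledGramFin F T) u₀ *
          adelicMpCont.proj F (Fin (n + n)) (doubledGramFin F T) (doublingDeltaLift F T hT))⁻¹ := by
  -- (term-mode chain: `rw` on these operator-valued goals runs `isDefEq` through the metaplectic instances and times out)
  have h1 := map_mul (adelicMpCont.proj F (Fin (n + n)) (doubledGramFin F T)) (u₀ * doublingDeltaLift F T hT * x) (u₀ * doublingDeltaLift F T hT)⁻¹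
  have h2 := map_mul (adelicMpCont.proj F (Fin (n + n)) (doubledGramFin F T)) (u₀ * doublingDeltaLift F T hT) x
  have h3 := map_inv (adelicMpCont.proj F (Fin (n + n)) (doubledGramFin F T)) (u₀ * doublingDeltaLift F T hT)
  have h4 := map_mul (adelicMpCont.proj F (Fin (n + n)) (doubledGramFin F T)) u₀ (doublingDeltaLift F T hT)
  exact h1.trans (congrArg₂ (· * ·) (h2.trans (congrArg₂ (· * ·) h4 hx)) (h3.trans (congrArg Inv.inv h4)))

/-- **THE IMPLEMENTERS OF A HOMOMORPHIC LIFT** (hypothesis `hIMPL` of ★ `exists_borelBound_frame`, discharged): for every compact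
`C ⊆ GL₂(𝔸_E)` inside `U_D`, `q_k := ũ · s(k) · ũ⁻¹` lies over `j k`, has modulus `≥ c₁ > 0` on `C` (★
`adelicMpCont.exists_pos_le_l2Scaling_conj_comp_of_isCompact` on the compact `C` read in the closed subgroup `U_D`), and `ω(q_k)Φ` is dominated
by one Schwartz–Bruhat function (`hdom`). [cite: Weil1965, n° 47 Lemme 20, n° 50] [cite: Weil1964, Chap. I n° 13 p. 160] -/
theorem implementers_of_hom
    [MeasurableSpace (AdeleRing (𝓞 F) F)] [BorelSpace (AdeleRing (𝓞 F) F)]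
    (ν : Measure (Fin (n + n) → AdeleRing (𝓞 F) F)) [ν.IsAddHaarMeasure] (Φ : piSchwartzBruhat F (Fin (n + n)))
    (u₀ : adelicMpCont F (Fin (n + n)) (doubledGramFin F (adelicGram F e TV TW)))
    (jS : ↥(UnitaryGroup.adelic F E c (1 + 1)
        ((Matrix.reindex finSumFinEquiv finSumFinEquiv (Matrix.fromBlocks TW 0 0 (-TW))).map (algebraMap F E))) →*
      ↥(symplecticGroup (polar (Matrix.toLinearMap₂' (AdeleRing (𝓞 F) F)
        (Matrix.fromBlocks (adelicGram F e TV TW) 0 0 (-adelicGram F e TV TW))))))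
    (hjS : ∀ (A : ↥(UnitaryGroup.adelic F E c (1 + 1)
        ((Matrix.reindex finSumFinEquiv finSumFinEquiv (Matrix.fromBlocks TW 0 0 (-TW))).map (algebraMap F E))))
        (v : (Fin (n + n) → AdeleRing (𝓞 F) F) × (Fin (n + n) → AdeleRing (𝓞 F) F)),
      ((spReindex (finSumFinEquiv : Fin n ⊕ Fin n ≃ Fin (n + n))
          (Matrix.fromBlocks (adelicGram F e TV TW) 0 0 (-adelicGram F e TV TW)) (jS A) :
          symplecticGroup (polar (Matrix.toLinearMap₂' (AdeleRing (𝓞 F) F)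
            (Matrix.reindex finSumFinEquiv finSumFinEquiv
              (Matrix.fromBlocks (adelicGram F e TV TW) 0 0 (-adelicGram F e TV TW)))))) :
        ((Fin (n + n) → AdeleRing (𝓞 F) F) × (Fin (n + n) → AdeleRing (𝓞 F) F)) ≃ₗ[AdeleRing (𝓞 F) F]
          ((Fin (n + n) → AdeleRing (𝓞 F) F) × (Fin (n + n) → AdeleRing (𝓞 F) F))) v =
      ((toSp F E c N (1 + 1)
          (((Equiv.prodCongr (Equiv.refl (Fin N)) finSumFinEquiv.symm).trans (Equiv.prodSumDistrib (Fin N) (Fin 1) (Fin 1))).trans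
            ((Equiv.sumCongr e e).trans finSumFinEquiv))
          (TV.map (algebraMap F E)) ((Matrix.reindex finSumFinEquiv finSumFinEquiv (Matrix.fromBlocks TW 0 0 (-TW))).map (algebraMap F E))
          hcδ hδ hd hV hW2 rfl rfl
          (adelicInr F E c N (1 + 1) (TV.map (algebraMap F E))
            ((Matrix.reindex finSumFinEquiv finSumFinEquiv (Matrix.fromBlocks TW 0 0 (-TW))).map (algebraMap F E)) A) :
          symplecticGroup (polar (adelicForm F (Fin (n + n))
            (adelicGram F
              (((Equiv.prodCongr (Equiv.refl (Fin N)) finSumFinEquiv.symm).trans (Equiv.prodSumDistrib (Fin N) (Fin 1) (Fin 1))).trans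
                ((Equiv.sumCongr e e).trans finSumFinEquiv)) TV
              (Matrix.reindex finSumFinEquiv finSumFinEquiv (Matrix.fromBlocks TW 0 0 (-TW))))))) :
        ((Fin (n + n) → AdeleRing (𝓞 F) F) × (Fin (n + n) → AdeleRing (𝓞 F) F)) ≃ₗ[AdeleRing (𝓞 F) F]
          ((Fin (n + n) → AdeleRing (𝓞 F) F) × (Fin (n + n) → AdeleRing (𝓞 F) F))) v)
    (j : ↥(UnitaryGroup.adelic F E c (1 + 1)
        ((Matrix.reindex finSumFinEquiv finSumFinEquiv (Matrix.fromBlocks TW 0 0 (-TW))).map (algebraMap F E))) →*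
      ↥(symplecticGroup (polar (adelicForm F (Fin (n + n)) (doubledGramFin F (adelicGram F e TV TW))))))
    (hj : j = (MulAut.conj (adelicMpCont.proj F (Fin (n + n)) (doubledGramFin F (adelicGram F e TV TW)) u₀ *
        adelicMpCont.proj F (Fin (n + n)) (doubledGramFin F (adelicGram F e TV TW))
          (doublingDeltaLift F (adelicGram F e TV TW) (isUnit_det_adelicGram F e hVd hWd)))).toMonoidHom.comp
      ((spReindex (finSumFinEquiv : Fin n ⊕ Fin n ≃ Fin (n + n))
        (Matrix.fromBlocks (adelicGram F e TV TW) 0 0 (-adelicGram F e TV TW))).comp jS))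
    (s : ↥(UnitaryGroup.adelic F E c (1 + 1)
        ((Matrix.reindex finSumFinEquiv finSumFinEquiv (Matrix.fromBlocks TW 0 0 (-TW))).map (algebraMap F E))) →*
      adelicMpCont F (Fin (n + n)) (doubledGramFin F (adelicGram F e TV TW)))
    (hs : Continuous fun A => (s A : adelicMp F (Fin (n + n)) (doubledGramFin F (adelicGram F e TV TW))))
    (hproj : ∀ (A : ↥(UnitaryGroup.adelic F E c (1 + 1)
        ((Matrix.reindex finSumFinEquiv finSumFinEquiv (Matrix.fromBlocks TW 0 0 (-TW))).map (algebraMap F E))))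
        (v : (Fin (n + n) → AdeleRing (𝓞 F) F) × (Fin (n + n) → AdeleRing (𝓞 F) F)),
      ((adelicMpCont.proj F (Fin (n + n)) (doubledGramFin F (adelicGram F e TV TW)) (s A) :
          symplecticGroup (polar (adelicForm F (Fin (n + n)) (doubledGramFin F (adelicGram F e TV TW))))) :
        ((Fin (n + n) → AdeleRing (𝓞 F) F) × (Fin (n + n) → AdeleRing (𝓞 F) F)) ≃ₗ[AdeleRing (𝓞 F) F]
          ((Fin (n + n) → AdeleRing (𝓞 F) F) × (Fin (n + n) → AdeleRing (𝓞 F) F))) v =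
      ((toSp F E c N (1 + 1)
          (((Equiv.prodCongr (Equiv.refl (Fin N)) finSumFinEquiv.symm).trans (Equiv.prodSumDistrib (Fin N) (Fin 1) (Fin 1))).trans
            ((Equiv.sumCongr e e).trans finSumFinEquiv))
          (TV.map (algebraMap F E)) ((Matrix.reindex finSumFinEquiv finSumFinEquiv (Matrix.fromBlocks TW 0 0 (-TW))).map (algebraMap F E))
          hcδ hδ hd hV hW2 rfl rfl
          (adelicInr F E c N (1 + 1) (TV.map (algebraMap F E))
            ((Matrix.reindex finSumFinEquiv finSumFinEquiv (Matrix.fromBlocks TW 0 0 (-TW))).map (algebraMap F E)) A) :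
          symplecticGroup (polar (adelicForm F (Fin (n + n))
            (adelicGram F
              (((Equiv.prodCongr (Equiv.refl (Fin N)) finSumFinEquiv.symm).trans (Equiv.prodSumDistrib (Fin N) (Fin 1) (Fin 1))).trans
                ((Equiv.sumCongr e e).trans finSumFinEquiv)) TV
              (Matrix.reindex finSumFinEquiv finSumFinEquiv (Matrix.fromBlocks TW 0 0 (-TW))))))) :
        ((Fin (n + n) → AdeleRing (𝓞 F) F) × (Fin (n + n) → AdeleRing (𝓞 F) F)) ≃ₗ[AdeleRing (𝓞 F) F]
          ((Fin (n + n) → AdeleRing (𝓞 F) F) × (Fin (n + n) → AdeleRing (𝓞 F) F))) v)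
    (hdom : ∀ C' : Set ↥(UnitaryGroup.adelic F E c (1 + 1)
        ((Matrix.reindex finSumFinEquiv finSumFinEquiv (Matrix.fromBlocks TW 0 0 (-TW))).map (algebraMap F E))), IsCompact C' →
      ∃ Φ₀ : piSchwartzBruhat F (Fin (n + n)), ∀ A ∈ C', ∀ x,
        ‖((adelicMpCont.omega F (Fin (n + n)) (doubledGramFin F (adelicGram F e TV TW))
              (u₀ * doublingDeltaLift F (adelicGram F e TV TW) (isUnit_det_adelicGram F e hVd hWd) * s A *
                (u₀ * doublingDeltaLift F (adelicGram F e TV TW) (isUnit_det_adelicGram F e hVd hWd))⁻¹) Φ : piSchwartzBruhat F (Fin (n + n))) :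
            (Fin (n + n) → AdeleRing (𝓞 F) F) → ℂ) x‖ ≤
          (((Φ₀ : piSchwartzBruhat F (Fin (n + n))) : (Fin (n + n) → AdeleRing (𝓞 F) F) → ℂ) x).re) :
    ∀ C : Set (GL (Fin (1 + 1)) (AdeleRing (𝓞 E) E)), IsCompact C →
      ∀ hCU : C ⊆ UnitaryGroup.adelic F E c (1 + 1)
        ((Matrix.reindex finSumFinEquiv finSumFinEquiv (Matrix.fromBlocks TW 0 0 (-TW))).map (algebraMap F E)),
      ∃ q : GL (Fin (1 + 1)) (AdeleRing (𝓞 E) E) → adelicMpCont F (Fin (n + n)) (doubledGramFin F (adelicGram F e TV TW)),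
        (∀ (k : GL (Fin (1 + 1)) (AdeleRing (𝓞 E) E)) (hk : k ∈ C),
          adelicMpCont.proj F (Fin (n + n)) (doubledGramFin F (adelicGram F e TV TW)) (q k) = j ⟨k, hCU hk⟩) ∧
        (∃ c₁ : ℝ, 0 < c₁ ∧ ∀ k ∈ C, c₁ ≤ (adelicMpCont.l2Scaling F (doubledGramFin F (adelicGram F e TV TW))
          (isUnit_det_doubledGramFin F (adelicGram F e TV TW) (isUnit_det_adelicGram F e hVd hWd)) ν (q k)).toReal) ∧
        ∃ Φ₀ : piSchwartzBruhat F (Fin (n + n)), ∀ k ∈ C, ∀ x,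
          ‖((adelicMpCont.omega F (Fin (n + n)) (doubledGramFin F (adelicGram F e TV TW)) (q k) Φ : piSchwartzBruhat F (Fin (n + n))) :
              (Fin (n + n) → AdeleRing (𝓞 F) F) → ℂ) x‖ ≤
            (((Φ₀ : piSchwartzBruhat F (Fin (n + n))) : (Fin (n + n) → AdeleRing (𝓞 F) F) → ℂ) x).re := by
  intro C hC hCU
  classical
  -- `C` read in the closed subgroup `U_D` is compact
  have hC' : IsCompact ((Subtype.val : ↥(UnitaryGroup.adelic F E c (1 + 1)
        ((Matrix.reindex finSumFinEquiv finSumFinEquiv (Matrix.fromBlocks TW 0 0 (-TW))).map (algebraMap F E))) →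
      GL (Fin (1 + 1)) (AdeleRing (𝓞 E) E)) ⁻¹' C) :=
    (isClosed_adelic F E c (1 + 1)
      ((Matrix.reindex finSumFinEquiv finSumFinEquiv (Matrix.fromBlocks TW 0 0 (-TW))).map (algebraMap F E))).isClosedEmbedding_subtypeVal.isCompact_preimage hC
  -- the moduli `L(ũ · s(k) · ũ⁻¹)`, `k ∈ C`, are `≥ c₁ > 0` (Borel structure on `U_D` for Steinhaus–Weil)
  letI : MeasurableSpace ↥(UnitaryGroup.adelic F E c (1 + 1)
        ((Matrix.reindex finSumFinEquiv finSumFinEquiv (Matrix.fromBlocks TW 0 0 (-TW))).map (algebraMap F E))) := borel _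
  haveI : BorelSpace ↥(UnitaryGroup.adelic F E c (1 + 1)
        ((Matrix.reindex finSumFinEquiv finSumFinEquiv (Matrix.fromBlocks TW 0 0 (-TW))).map (algebraMap F E))) := ⟨rfl⟩
  have hmod := adelicMpCont.exists_pos_le_l2Scaling_conj_comp_of_isCompact F (doubledGramFin F (adelicGram F e TV TW))
    (isUnit_det_doubledGramFin F (adelicGram F e TV TW) (isUnit_det_adelicGram F e hVd hWd)) ν s hs
    (u₀ * doublingDeltaLift F (adelicGram F e TV TW) (isUnit_det_adelicGram F e hVd hWd)) hC'
  obtain ⟨c₁, _c₂, hc₁, hc⟩ := hmod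
  have hd' := hdom _ hC'
  obtain ⟨Φ₀, hΦ₀⟩ := hd'
  -- the implementers `q k := ũ · s(k) · ũ⁻¹` on `U_D` (extended by `1` off it)
  let q : GL (Fin (1 + 1)) (AdeleRing (𝓞 E) E) → adelicMpCont F (Fin (n + n)) (doubledGramFin F (adelicGram F e TV TW)) :=
    Function.extend Subtype.val (fun A : ↥(UnitaryGroup.adelic F E c (1 + 1)
        ((Matrix.reindex finSumFinEquiv finSumFinEquiv (Matrix.fromBlocks TW 0 0 (-TW))).map (algebraMap F E))) =>
      u₀ * doublingDeltaLift F (adelicGram F e TV TW) (isUnit_det_adelicGram F e hVd hWd) * s A *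
        (u₀ * doublingDeltaLift F (adelicGram F e TV TW) (isUnit_det_adelicGram F e hVd hWd))⁻¹) 1
  have hq : ∀ (k : GL (Fin (1 + 1)) (AdeleRing (𝓞 E) E)) (hk : k ∈ UnitaryGroup.adelic F E c (1 + 1)
        ((Matrix.reindex finSumFinEquiv finSumFinEquiv (Matrix.fromBlocks TW 0 0 (-TW))).map (algebraMap F E))),
      q k = u₀ * doublingDeltaLift F (adelicGram F e TV TW) (isUnit_det_adelicGram F e hVd hWd) * s ⟨k, hk⟩ *
        (u₀ * doublingDeltaLift F (adelicGram F e TV TW) (isUnit_det_adelicGram F e hVd hWd))⁻¹ := fun k hk =>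
    Subtype.val_injective.extend_apply _ _ ⟨k, hk⟩
  refine ⟨q, fun k hk => ?_, ⟨c₁, hc₁, fun k hk => ?_⟩, ⟨Φ₀, fun k hk x => ?_⟩⟩
  · -- over `j k = (π u₀ · π δ̃) · spReindex (jS k) · (π u₀ · π δ̃)⁻¹` (`hj`), and `π(s k) = spReindex (jS k)` by `hproj`/`hjS`
    have hjk := (DFunLike.congr_fun hj ⟨k, hCU hk⟩).trans
      (conj_comp_comp_apply
        (adelicMpCont.proj F (Fin (n + n)) (doubledGramFin F (adelicGram F e TV TW)) u₀ *
          adelicMpCont.proj F (Fin (n + n)) (doubledGramFin F (adelicGram F e TV TW))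
            (doublingDeltaLift F (adelicGram F e TV TW) (isUnit_det_adelicGram F e hVd hWd)))
        (spReindex (finSumFinEquiv : Fin n ⊕ Fin n ≃ Fin (n + n))
          (Matrix.fromBlocks (adelicGram F e TV TW) 0 0 (-adelicGram F e TV TW))) jS ⟨k, hCU hk⟩)
    exact (congrArg (adelicMpCont.proj F (Fin (n + n)) (doubledGramFin F (adelicGram F e TV TW))) (hq k (hCU hk))).trans
      ((proj_conj_frame_eq F (adelicGram F e TV TW) (isUnit_det_adelicGram F e hVd hWd) u₀ (s ⟨k, hCU hk⟩) (jS ⟨k, hCU hk⟩)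
        (Subtype.ext (LinearEquiv.ext fun v => (hproj ⟨k, hCU hk⟩ v).trans (hjS ⟨k, hCU hk⟩ v).symm))).trans hjk.symm)
  · exact (hc ⟨k, hCU hk⟩ hk).1.trans_eq
      (congrArg (fun p => (adelicMpCont.l2Scaling F (doubledGramFin F (adelicGram F e TV TW))
        (isUnit_det_doubledGramFin F (adelicGram F e TV TW) (isUnit_det_adelicGram F e hVd hWd)) ν p).toReal) (hq k (hCU hk))).symm
  · exact (congrArg (fun p => ‖((adelicMpCont.omega F (Fin (n + n)) (doubledGramFin F (adelicGram F e TV TW)) p Φ :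
        piSchwartzBruhat F (Fin (n + n))) : (Fin (n + n) → AdeleRing (𝓞 F) F) → ℂ) x‖) (hq k (hCU hk))).trans_le
      (hΦ₀ ⟨k, hCU hk⟩ hk x)

set_option maxHeartbeats 400000 in
/-- **(**)′ IN THE δ♮-FRAME, (RAY) DISCHARGED AND (IMPL)+(DOM-C) READ FROM A HOMOMORPHIC LIFT `s : U_D → Mp` OVER `j`.**  See the module
docstring.  Conclusion: one constant `M` with `‖E″(ω(p)Φ)‖ ≤ M · √L(p)` for every `p ∈ Mp` over `j b`, `b ∈ U_D` Borel.
[cite: Weil1965, n° 47 Lemme 20, n° 50] [cite: Weil1964, Chap. I n° 13 p. 160] [cite: GelbartRogawski1991, §3.2] [cite: Li1992, p. 181] -/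
theorem exists_borelBound_frame_of_hom [IsTotallyReal F] [IsGalois F E] (h2 : ∀ σ : E ≃ₐ[F] E, σ = 1 ∨ σ = c) (hTW : TW 0 0 ≠ 0)
    (hTs : (adelicGram F e TV TW).IsSymm)
    [MeasurableSpace (AdeleRing (𝓞 F) F)] [BorelSpace (AdeleRing (𝓞 F) F)]
    (ν : Measure (Fin (n + n) → AdeleRing (𝓞 F) F)) [ν.IsAddHaarMeasure]
    (E'' : piSchwartzBruhat F (Fin (n + n)) →ₗ[ℂ] ℂ) (Φ : piSchwartzBruhat F (Fin (n + n)))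
    -- the frame chirp as an element of `Mp` (★ `exists_frameUnipPair`)
    (u₀ : adelicMpCont F (Fin (n + n)) (doubledGramFin F (adelicGram F e TV TW)))
    (hu₀ : ∀ Ψ : piSchwartzBruhat F (Fin (n + n)),
      ((adelicMpCont.omega F (Fin (n + n)) (doubledGramFin F (adelicGram F e TV TW)) u₀ Ψ : piSchwartzBruhat F (Fin (n + n))) :
          (Fin (n + n) → AdeleRing (𝓞 F) F) → ℂ) =
        chirp F (ratMatrix F (frameHalfRat F)) (Ψ : (Fin (n + n) → AdeleRing (𝓞 F) F) → ℂ))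
    -- the `W`-side hom into the sum model (★ `exists_sumModelHom`, first conjunct)
    (jS : ↥(UnitaryGroup.adelic F E c (1 + 1)
        ((Matrix.reindex finSumFinEquiv finSumFinEquiv (Matrix.fromBlocks TW 0 0 (-TW))).map (algebraMap F E))) →*
      ↥(symplecticGroup (polar (Matrix.toLinearMap₂' (AdeleRing (𝓞 F) F)
        (Matrix.fromBlocks (adelicGram F e TV TW) 0 0 (-adelicGram F e TV TW))))))
    (hjS : ∀ (A : ↥(UnitaryGroup.adelic F E c (1 + 1)
        ((Matrix.reindex finSumFinEquiv finSumFinEquiv (Matrix.fromBlocks TW 0 0 (-TW))).map (algebraMap F E))))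
        (v : (Fin (n + n) → AdeleRing (𝓞 F) F) × (Fin (n + n) → AdeleRing (𝓞 F) F)),
      ((spReindex (finSumFinEquiv : Fin n ⊕ Fin n ≃ Fin (n + n))
          (Matrix.fromBlocks (adelicGram F e TV TW) 0 0 (-adelicGram F e TV TW)) (jS A) :
          symplecticGroup (polar (Matrix.toLinearMap₂' (AdeleRing (𝓞 F) F)
            (Matrix.reindex finSumFinEquiv finSumFinEquiv
              (Matrix.fromBlocks (adelicGram F e TV TW) 0 0 (-adelicGram F e TV TW)))))) :
        ((Fin (n + n) → AdeleRing (𝓞 F) F) × (Fin (n + n) → AdeleRing (𝓞 F) F)) ≃ₗ[AdeleRing (𝓞 F) F]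
          ((Fin (n + n) → AdeleRing (𝓞 F) F) × (Fin (n + n) → AdeleRing (𝓞 F) F))) v =
      ((toSp F E c N (1 + 1)
          (((Equiv.prodCongr (Equiv.refl (Fin N)) finSumFinEquiv.symm).trans (Equiv.prodSumDistrib (Fin N) (Fin 1) (Fin 1))).trans
            ((Equiv.sumCongr e e).trans finSumFinEquiv))
          (TV.map (algebraMap F E)) ((Matrix.reindex finSumFinEquiv finSumFinEquiv (Matrix.fromBlocks TW 0 0 (-TW))).map (algebraMap F E))
          hcδ hδ hd hV hW2 rfl rfl
          (adelicInr F E c N (1 + 1) (TV.map (algebraMap F E))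
            ((Matrix.reindex finSumFinEquiv finSumFinEquiv (Matrix.fromBlocks TW 0 0 (-TW))).map (algebraMap F E)) A) :
          symplecticGroup (polar (adelicForm F (Fin (n + n))
            (adelicGram F
              (((Equiv.prodCongr (Equiv.refl (Fin N)) finSumFinEquiv.symm).trans (Equiv.prodSumDistrib (Fin N) (Fin 1) (Fin 1))).trans
                ((Equiv.sumCongr e e).trans finSumFinEquiv)) TV
              (Matrix.reindex finSumFinEquiv finSumFinEquiv (Matrix.fromBlocks TW 0 0 (-TW))))))) :
        ((Fin (n + n) → AdeleRing (𝓞 F) F) × (Fin (n + n) → AdeleRing (𝓞 F) F)) ≃ₗ[AdeleRing (𝓞 F) F]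
          ((Fin (n + n) → AdeleRing (𝓞 F) F) × (Fin (n + n) → AdeleRing (𝓞 F) F))) v)
    -- THE HOM OF RECORD `j = conj(π u₀ · π(doublingDeltaLift)) ∘ spReindex ∘ jS`
    (j : ↥(UnitaryGroup.adelic F E c (1 + 1)
        ((Matrix.reindex finSumFinEquiv finSumFinEquiv (Matrix.fromBlocks TW 0 0 (-TW))).map (algebraMap F E))) →*
      ↥(symplecticGroup (polar (adelicForm F (Fin (n + n)) (doubledGramFin F (adelicGram F e TV TW))))))
    (hj : j = (MulAut.conj (adelicMpCont.proj F (Fin (n + n)) (doubledGramFin F (adelicGram F e TV TW)) u₀ *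
        adelicMpCont.proj F (Fin (n + n)) (doubledGramFin F (adelicGram F e TV TW))
          (doublingDeltaLift F (adelicGram F e TV TW) (isUnit_det_adelicGram F e hVd hWd)))).toMonoidHom.comp
      ((spReindex (finSumFinEquiv : Fin n ⊕ Fin n ≃ Fin (n + n))
        (Matrix.fromBlocks (adelicGram F e TV TW) 0 0 (-adelicGram F e TV TW))).comp jS))
    -- (INV): rational elements have isometric `E″`-invariant lifts over `j`
    (hINV : ∀ (γ : GL (Fin (1 + 1)) (AdeleRing (𝓞 E) E))
      (hγ : γ ∈ UnitaryGroup.adelic F E c (1 + 1)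
        ((Matrix.reindex finSumFinEquiv finSumFinEquiv (Matrix.fromBlocks TW 0 0 (-TW))).map (algebraMap F E))),
      γ ∈ (Matrix.GeneralLinearGroup.map (algebraMap E (AdeleRing (𝓞 E) E))).range →
      ∃ r : adelicMpCont F (Fin (n + n)) (doubledGramFin F (adelicGram F e TV TW)),
        adelicMpCont.proj F (Fin (n + n)) (doubledGramFin F (adelicGram F e TV TW)) r = j ⟨γ, hγ⟩ ∧
        adelicMpCont.l2Scaling F (doubledGramFin F (adelicGram F e TV TW))
          (isUnit_det_doubledGramFin F (adelicGram F e TV TW) (isUnit_det_adelicGram F e hVd hWd)) ν r = 1 ∧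
        E'' ∘ₗ adelicMpCont.omega F (Fin (n + n)) (doubledGramFin F (adelicGram F e TV TW)) r⁻¹ = E'')
    -- (IMPL) + (DOM-C) FROM A HOMOMORPHIC LIFT: a coefficient-continuous hom `s : U_D → Mp` over `spReindex ∘ jS` (read through the pair
    -- embedding exactly as `hjS`), and ONE dominating Schwartz–Bruhat function for `ω(ũ · s(k) · ũ⁻¹)Φ` over every compact subset of `U_D`,
    -- `ũ = u₀ · doublingDeltaLift`
    (s : ↥(UnitaryGroup.adelic F E c (1 + 1)
        ((Matrix.reindex finSumFinEquiv finSumFinEquiv (Matrix.fromBlocks TW 0 0 (-TW))).map (algebraMap F E))) →*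
      adelicMpCont F (Fin (n + n)) (doubledGramFin F (adelicGram F e TV TW)))
    (hs : Continuous fun A => (s A : adelicMp F (Fin (n + n)) (doubledGramFin F (adelicGram F e TV TW))))
    (hproj : ∀ (A : ↥(UnitaryGroup.adelic F E c (1 + 1)
        ((Matrix.reindex finSumFinEquiv finSumFinEquiv (Matrix.fromBlocks TW 0 0 (-TW))).map (algebraMap F E))))
        (v : (Fin (n + n) → AdeleRing (𝓞 F) F) × (Fin (n + n) → AdeleRing (𝓞 F) F)),
      ((adelicMpCont.proj F (Fin (n + n)) (doubledGramFin F (adelicGram F e TV TW)) (s A) :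
          symplecticGroup (polar (adelicForm F (Fin (n + n)) (doubledGramFin F (adelicGram F e TV TW))))) :
        ((Fin (n + n) → AdeleRing (𝓞 F) F) × (Fin (n + n) → AdeleRing (𝓞 F) F)) ≃ₗ[AdeleRing (𝓞 F) F]
          ((Fin (n + n) → AdeleRing (𝓞 F) F) × (Fin (n + n) → AdeleRing (𝓞 F) F))) v =
      ((toSp F E c N (1 + 1)
          (((Equiv.prodCongr (Equiv.refl (Fin N)) finSumFinEquiv.symm).trans (Equiv.prodSumDistrib (Fin N) (Fin 1) (Fin 1))).trans
            ((Equiv.sumCongr e e).trans finSumFinEquiv))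
          (TV.map (algebraMap F E)) ((Matrix.reindex finSumFinEquiv finSumFinEquiv (Matrix.fromBlocks TW 0 0 (-TW))).map (algebraMap F E))
          hcδ hδ hd hV hW2 rfl rfl
          (adelicInr F E c N (1 + 1) (TV.map (algebraMap F E))
            ((Matrix.reindex finSumFinEquiv finSumFinEquiv (Matrix.fromBlocks TW 0 0 (-TW))).map (algebraMap F E)) A) :
          symplecticGroup (polar (adelicForm F (Fin (n + n))
            (adelicGram F
              (((Equiv.prodCongr (Equiv.refl (Fin N)) finSumFinEquiv.symm).trans (Equiv.prodSumDistrib (Fin N) (Fin 1) (Fin 1))).trans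
                ((Equiv.sumCongr e e).trans finSumFinEquiv)) TV
              (Matrix.reindex finSumFinEquiv finSumFinEquiv (Matrix.fromBlocks TW 0 0 (-TW))))))) :
        ((Fin (n + n) → AdeleRing (𝓞 F) F) × (Fin (n + n) → AdeleRing (𝓞 F) F)) ≃ₗ[AdeleRing (𝓞 F) F]
          ((Fin (n + n) → AdeleRing (𝓞 F) F) × (Fin (n + n) → AdeleRing (𝓞 F) F))) v)
    (hdom : ∀ C' : Set ↥(UnitaryGroup.adelic F E c (1 + 1)
        ((Matrix.reindex finSumFinEquiv finSumFinEquiv (Matrix.fromBlocks TW 0 0 (-TW))).map (algebraMap F E))), IsCompact C' →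
      ∃ Φ₀ : piSchwartzBruhat F (Fin (n + n)), ∀ A ∈ C', ∀ x,
        ‖((adelicMpCont.omega F (Fin (n + n)) (doubledGramFin F (adelicGram F e TV TW))
              (u₀ * doublingDeltaLift F (adelicGram F e TV TW) (isUnit_det_adelicGram F e hVd hWd) * s A *
                (u₀ * doublingDeltaLift F (adelicGram F e TV TW) (isUnit_det_adelicGram F e hVd hWd))⁻¹) Φ : piSchwartzBruhat F (Fin (n + n))) :
            (Fin (n + n) → AdeleRing (𝓞 F) F) → ℂ) x‖ ≤
          (((Φ₀ : piSchwartzBruhat F (Fin (n + n))) : (Fin (n + n) → AdeleRing (𝓞 F) F) → ℂ) x).re)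
    -- the (Î)/(E_X) structure of `E″`
    {Sr : Matrix (Fin (n + n)) (Fin (n + n)) F} (hSr : Sr.IsSymm) (hSrdet : Sr.det ≠ 0)
    (EI EE : piSchwartzBruhat F (Fin (n + n)) →ₗ[ℂ] ℂ) (κ : ℝ≥0∞) (hκ : κ ≠ ⊤)
    (hsplit : ∀ Ψ : piSchwartzBruhat F (Fin (n + n)), (‖E'' Ψ‖ₑ : ℝ≥0∞) ≤ ‖EI Ψ‖ₑ + κ * ‖EE Ψ‖ₑ)
    {ι : Type*} (Ω : Set ι) (L : ι → GL (Fin (n + n)) (AdeleRing (𝓞 F) F)) (cI : ℝ≥0∞) (hcI : cI ≠ ⊤)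
    (hI : ∀ (Ψ : piSchwartzBruhat F (Fin (n + n))) (B : ℝ≥0∞),
      (∀ h ∈ Ω, ∑' v : ↥{v : Fin (n + n) → F | v ≠ 0},
        (‖(Ψ : (Fin (n + n) → AdeleRing (𝓞 F) F) → ℂ) (ratVec F (v : Fin (n + n) → F) ᵥ*
          (L h : Matrix (Fin (n + n)) (Fin (n + n)) (AdeleRing (𝓞 F) F)))‖ₑ : ℝ≥0∞) ≤ B) → (‖EI Ψ‖ₑ : ℝ≥0∞) ≤ cI * B)
    {𝒴 : Set (GL (Fin (n + n)) (FiniteAdeleRing (𝓞 F) F))} (h𝒴 : IsCompact 𝒴) {H₀ : ℝ}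
    (hL : ∀ h ∈ Ω, GLn.sndHom (n + n) F (L h) ∈ 𝒴 ∧ (GLn.archHeight (n + n) F (L h) : ℝ) ≤ H₀)
    (hEE : ∀ Ψ : piSchwartzBruhat F (Fin (n + n)), (‖EE Ψ‖ₑ : ℝ≥0∞) ≤
      ∑' ξ : F, (‖∫ x, chirp F ((algebraMap F (AdeleRing (𝓞 F) F) ξ) • ratMatrix F Sr)
        ((Ψ : piSchwartzBruhat F (Fin (n + n))) : (Fin (n + n) → AdeleRing (𝓞 F) F) → ℂ) x ∂ν‖ₑ : ℝ≥0∞))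
    (hEEmono : ∀ Ψ Ψ' : piSchwartzBruhat F (Fin (n + n)),
      (∀ x, ‖(Ψ : (Fin (n + n) → AdeleRing (𝓞 F) F) → ℂ) x‖ ≤ ((Ψ' : (Fin (n + n) → AdeleRing (𝓞 F) F) → ℂ) x).re) →
        (‖EE Ψ‖ₑ : ℝ≥0∞) ≤ ‖EE Ψ'‖ₑ)
    (hn : 2 < n) :
    ∃ Mbound : ℝ, ∀ (p : adelicMpCont F (Fin (n + n)) (doubledGramFin F (adelicGram F e TV TW)))
      (b : GL (Fin (1 + 1)) (AdeleRing (𝓞 E) E))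
      (hb : b ∈ UnitaryGroup.adelic F E c (1 + 1)
        ((Matrix.reindex finSumFinEquiv finSumFinEquiv (Matrix.fromBlocks TW 0 0 (-TW))).map (algebraMap F E))),
      (b : Matrix (Fin (1 + 1)) (Fin (1 + 1)) (AdeleRing (𝓞 E) E)) 0 0 + (b : Matrix (Fin (1 + 1)) (Fin (1 + 1)) (AdeleRing (𝓞 E) E)) 0 1 =
        (b : Matrix (Fin (1 + 1)) (Fin (1 + 1)) (AdeleRing (𝓞 E) E)) 1 0 + (b : Matrix (Fin (1 + 1)) (Fin (1 + 1)) (AdeleRing (𝓞 E) E)) 1 1 →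
      adelicMpCont.proj F (Fin (n + n)) (doubledGramFin F (adelicGram F e TV TW)) p = j ⟨b, hb⟩ →
      ‖E'' (adelicMpCont.omega F (Fin (n + n)) (doubledGramFin F (adelicGram F e TV TW)) p Φ)‖ ≤
        Mbound * Real.sqrt (adelicMpCont.l2Scaling F (doubledGramFin F (adelicGram F e TV TW))
          (isUnit_det_doubledGramFin F (adelicGram F e TV TW) (isUnit_det_adelicGram F e hVd hWd)) ν p).toReal :=
  E2SWBorelBoundFrame.exists_borelBound_frame F E c hcδ hδ hd N e TW hV hW2 hVd hWd h2 hTW hTs ν E'' Φ u₀ hu₀ jS hjS j hj hINV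
    (implementers_of_hom F E c hcδ hδ hd N e TW hV hW2 hVd hWd ν Φ u₀ jS hjS j hj s hs hproj hdom)
    hSr hSrdet EI EE κ hκ hsplit Ω L cI hcI hI h𝒴 hL hEE hEEmono hn

end Summit.HodgeConjecture.HodgeConjecture.Cruxes.H413.E2SWBorelBoundFrameHom

end
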